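import Literature.LinearAlgebra.Matrix.HermitianAdjointCartanAlgebra
import Literature.LinearAlgebra.Matrix.CyclicVectorCompanionMatrix
import Mathlib.RingTheory.Norm.Basic
import Mathlib.RingTheory.TensorProduct.Pi
import Mathlib.RingTheory.Artinian.Module
import Mathlib.LinearAlgebra.TensorProduct.Pi
import Mathlib.LinearAlgebra.Matrix.Charpoly.Minpoly
import HarnessLib

/-!
# The determinant on the base-changed Cartan algebra `R ⊗_L L[γ]` is the norm, and the norm of a base-changed étale algebra
# is the product of the norms of its simple factors (Bourbaki, *Algebra* III §9; Atiyah–Macdonald Thm. 8.7; Rogawski 1990 §3.5)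

Topic `LinearAlgebra/Matrix`; namespace `Literature.LinearAlgebra.Matrix`.  THEOREMS ONLY (no definition, no instance, no notation, no
named fact); universe-polymorphic pure algebra.  Sequel of ★ `HermitianAdjointCartanAlgebra` (the Cartan algebra `L[γ] = Z(γ)` of a regular
semisimple matrix) for the row G6∕R6d «det-reading» of the floor-0 unitary stabilisation (engine T1): the bridge from the DETERMINANT of the
adelic Cartan class `x_g = Ψ(X) ∈ M_N(𝔸_L)` to the NORMS of the simple factors `K_𝔪 = L[γ]∕𝔪` that carry the obstruction of
[Rogawski1990, §3.5 Prop. 3.5.2] — here over an ARBITRARY commutative `L`-algebra `R` (consumer: `R = 𝔸_L`,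
`GaloisRepresentations/HasseNormEtaleInvolutionNorm`).

* §1 (private plumbing) `det (blockDiagonal' d) = ∏ det dₖ`, the norm of a finite product of finite free algebras is the product of the norms.
* §2 **`norm_tensor_eq_prod_norm_map_mk`**: for `B` a REDUCED finite commutative algebra over a field `L` (`B ≅ ∏_𝔪 B∕𝔪`, Mathlib
  `IsArtinianRing.equivPi`) and any commutative `L`-algebra `R`,
  `Algebra.norm R x = ∏_𝔪 Algebra.norm R ((1 ⊗ π_𝔪) x)` on `R ⊗_L B` (`R ⊗_L B ≅ ∏_𝔪 R ⊗_L B∕𝔪`, Mathlib `Algebra.TensorProduct.piRight`).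
* §3 **`det_eq_norm_of_apply_tmul`**: for `γ ∈ M_N(L)` regular semisimple (separable characteristic polynomial) and ANY `R`-algebra map
  `Ψ : R ⊗_L L[γ] → M_N(R)` with `Ψ (r ⊗ b) = r • b`: `det (Ψ x) = Algebra.norm R x` — a cyclic vector `v` of `γ` (★
  `exists_basis_toMatrix_eq_companion`) identifies the `L[γ]`-module `L^N` with `L[γ]` (`b ↦ b v`), so after `R ⊗_L −` left multiplication by
  `x` is conjugate to the matrix `Ψ x` (Mathlib `LinearMap.det_conj`, `LinearMap.det_toLin'`); with §2:
  **`det_eq_prod_norm_map_mk`**: `det (Ψ x) = ∏_𝔪 Algebra.norm R ((1 ⊗ π_𝔪) x)`.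

## References
* N. Bourbaki, *Algebra I, Chapters 1–3* (1989), Ch. III §9 no. 3–4 (norm of an element = determinant of its regular representation; norms of
  products) — cited through [Lang2002, Ch. VI §5 Prop. 5.6 and Ch. XVI §7].
* M. F. Atiyah, I. G. Macdonald, *Introduction to Commutative Algebra* (1969), Ch. 8 Thm. 8.7 [AtiyahMacdonald1969].
* R. A. Horn, C. R. Johnson, *Matrix Analysis*, 2nd ed. (2013), Thm. 3.2.4.2 ∕ 3.3.15 p. 236 (nonderogatory ⟺ cyclic) [HornJohnson2013].
* J. D. Rogawski, *Automorphic Representations of Unitary Groups in Three Variables* (1990), §3.5 p. 29 [Rogawski1990].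
-/

open scoped TensorProduct Matrix

namespace Literature.LinearAlgebra.Matrix

/-! ## §1 Norms on finite products of finite free algebras (plumbing) -/

section PiNorm

variable {R : Type*} [CommRing R]

/-- `det (blockDiagonal' d) = ∏ₖ det dₖ` for square blocks of different sizes (block-triangular along an enumeration of the block index;
Mathlib's `Matrix.det_blockDiagonal` is the equal-size case). [folklore] -/
private theorem det_blockDiagonal'_pi {κ : Type*} [Fintype κ] [DecidableEq κ] {σ : κ → Type*} [∀ k, Fintype (σ k)]
    [∀ k, DecidableEq (σ k)] (d : ∀ k, Matrix (σ k) (σ k) R) :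
    (Matrix.blockDiagonal' d).det = ∏ k, (d k).det := by
  let e := Fintype.equivFin κ
  have hT : (Matrix.blockDiagonal' d).BlockTriangular (fun a : Σ j, σ j => e a.1) := by
    rintro ⟨i, x⟩ ⟨j, y⟩ h
    exact Matrix.blockDiagonal'_apply_ne d x y fun hij => absurd (congrArg (⇑e) hij.symm) (ne_of_lt h)
  rw [hT.det_fintype]
  refine (Fintype.prod_equiv e (fun k => (d k).det) _ fun k => ?_).symm
  let f₀ : σ k ≃ {a : Σ j, σ j // a.1 = k} :=
    { toFun := fun x => ⟨⟨k, x⟩, rfl⟩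
      invFun := fun a => a.2 ▸ a.1.2
      left_inv := fun _ => rfl
      right_inv := by
        rintro ⟨⟨j, x⟩, h⟩
        subst h
        rfl }
  let f : σ k ≃ {a : Σ j, σ j // e a.1 = e k} := f₀.trans (Equiv.subtypeEquivRight fun a => e.injective.eq_iff.symm)
  rw [Matrix.toSquareBlock_def, ← Matrix.det_submatrix_equiv_self f]
  congr 1
  ext x y
  simp only [Matrix.submatrix_apply]
  exact (Matrix.blockDiagonal'_apply_eq d k x y).symm

variable {ι : Type*} [Fintype ι] [DecidableEq ι]

/-- In the basis of `Πᵢ Mᵢ` assembled from bases of the `Mᵢ`, `⊕ᵢ fᵢ` has the matrix `blockDiagonal' (matrix of fᵢ)`. [folklore] -/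
private theorem toMatrix_pi_eq_blockDiagonal'_pi {M : ι → Type*} [∀ i, AddCommGroup (M i)] [∀ i, Module R (M i)]
    {κ : ι → Type*} [∀ i, Fintype (κ i)] [∀ i, DecidableEq (κ i)]
    (b : ∀ i, Module.Basis (κ i) R (M i)) (f : ∀ i, M i →ₗ[R] M i) :
    LinearMap.toMatrix (Pi.basis b) (Pi.basis b) (LinearMap.pi fun i => (f i).comp (LinearMap.proj i)) =
      Matrix.blockDiagonal' fun i => LinearMap.toMatrix (b i) (b i) (f i) := by
  ext ⟨s, i⟩ ⟨s', j⟩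
  rw [LinearMap.toMatrix_apply, Pi.basis_apply, Pi.basis_repr]
  simp only [LinearMap.pi_apply, LinearMap.comp_apply, LinearMap.proj_apply]
  by_cases h : s = s'
  · subst h
    rw [Matrix.blockDiagonal'_apply_eq, Pi.single_eq_same, LinearMap.toMatrix_apply]
  · rw [Matrix.blockDiagonal'_apply_ne _ _ _ h, Pi.single_eq_of_ne h, map_zero, map_zero, Finsupp.zero_apply]

/-- `N_{ΠAᵢ/R}(w) = ∏ᵢ N_{Aᵢ/R}(wᵢ)` for finite free commutative `R`-algebras `Aᵢ` of different ranks (Mathlib's `LinearMap.det_pi` is the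
constant-fibre case). [folklore] -/
private theorem norm_pi_apply_pi {A : ι → Type*} [∀ i, CommRing (A i)] [∀ i, Algebra R (A i)] [∀ i, Module.Free R (A i)]
    [∀ i, Module.Finite R (A i)] (w : Π i, A i) :
    Algebra.norm R w = ∏ i, Algebra.norm R (w i) := by
  classical
  have hl : (Algebra.lmul R (Π i, A i) w : Module.End R (Π i, A i)) =
      LinearMap.pi fun i => (Algebra.lmul R (A i) (w i) : Module.End R (A i)).comp (LinearMap.proj i) :=
    LinearMap.ext fun y => funext fun i => rfl
  let b := fun i => Module.Free.chooseBasis R (A i)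
  rw [Algebra.norm_apply, hl, ← LinearMap.det_toMatrix (Pi.basis b), toMatrix_pi_eq_blockDiagonal'_pi, det_blockDiagonal'_pi]
  exact Finset.prod_congr rfl fun i _ => by rw [LinearMap.det_toMatrix, ← Algebra.norm_apply]

end PiNorm

/-! ## §2 The norm of a base-changed reduced algebra is the product of the norms of its simple factors -/

section EtaleBaseChange

variable (L : Type*) [Field L] (B : Type*) [CommRing B] [Algebra L B] [Module.Finite L B] [IsReduced B]
  (R : Type*) [CommRing R] [Algebra L R]

/-- **`N_{(R ⊗_L B)/R}(x) = ∏_𝔪 N_{(R ⊗_L B∕𝔪)/R}((1 ⊗ π_𝔪) x)`** for a REDUCED finite commutative algebra `B` over a field `L`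
(`B ≅ ∏_𝔪 B∕𝔪` over its maximal ideals, [AtiyahMacdonald1969, Thm. 8.7]) and any commutative `L`-algebra `R`: the norm of the étale algebra
`R ⊗_L B ≅ ∏_𝔪 R ⊗_L K_𝔪` is the product of the norms of its factors (the norm of a product algebra is the product of the norms,
[Lang2002, Ch. XVI §7]; `R = 𝔸_L`: «`det x = ∏ N_{K_𝔪/L}(x_𝔪)` as idèles»). [cite: AtiyahMacdonald1969, Ch. 8 Thm 8.7] [cite: Lang2002, Ch. VI §5 Prop. 5.6] -/
theorem norm_tensor_eq_prod_norm_map_mk [Fintype (MaximalSpectrum B)] (x : R ⊗[L] B) :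
    Algebra.norm R x = ∏ I : MaximalSpectrum B,
      Algebra.norm R (Algebra.TensorProduct.map (AlgHom.id R R) (Ideal.Quotient.mkₐ L I.asIdeal) x) := by
  classical
  haveI : IsArtinianRing B := IsArtinianRing.of_finite L B
  haveI : ∀ I : MaximalSpectrum B, Module.Finite L (B ⧸ I.asIdeal) := fun I =>
    Module.Finite.of_surjective (Ideal.Quotient.mkₐ L I.asIdeal).toLinearMap (Ideal.Quotient.mkₐ_surjective L _)
  let π : B ≃ₐ[L] (Π I : MaximalSpectrum B, B ⧸ I.asIdeal) := (IsArtinianRing.equivPi B).restrictScalars L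
  let e : R ⊗[L] B ≃ₐ[R] Π I : MaximalSpectrum B, R ⊗[L] (B ⧸ I.asIdeal) :=
    (Algebra.TensorProduct.congr (AlgEquiv.refl : R ≃ₐ[R] R) π).trans
      (Algebra.TensorProduct.piRight L R R (fun I : MaximalSpectrum B => B ⧸ I.asIdeal))
  have he : ∀ (y : R ⊗[L] B) (I : MaximalSpectrum B),
      e y I = Algebra.TensorProduct.map (AlgHom.id R R) (Ideal.Quotient.mkₐ L I.asIdeal) y := by
    intro y I
    induction y using TensorProduct.induction_on with
    | zero => simp only [map_zero, Pi.zero_apply]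
    | tmul r b =>
        rw [Algebra.TensorProduct.map_tmul]
        rfl
    | add y z hy hz => simp only [map_add, Pi.add_apply, hy, hz]
  rw [← Algebra.norm_eq_of_algEquiv e x, norm_pi_apply_pi]
  exact Finset.prod_congr rfl fun I _ => by rw [he]

end EtaleBaseChange

/-! ## §3 `det ∘ Ψ = N_{(R ⊗_L L[γ])/R}` for the Cartan algebra of a regular semisimple matrix (cyclic vector) -/

section DetNorm

variable {L : Type*} [Field L] {N : ℕ} (γ : Matrix (Fin N) (Fin N) L) (R : Type*) [CommRing R] [Algebra L R]

/-- **`det (Ψ x) = N_{(R ⊗_L L[γ])/R}(x)`** for `γ` regular semisimple and any `R`-algebra map `Ψ : R ⊗_L L[γ] → M_N(R)` with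
`Ψ(r ⊗ b) = r • b` (the base change of `L[γ] ⊆ M_N(L)`): a cyclic vector `v` of `γ` (`v, γv, …, γ^{N−1}v` a basis — nonderogatory ⟺ cyclic,
[HornJohnson2013, Thm. 3.3.15]) makes `b ↦ b·v` an isomorphism of `L[γ]`-modules `L[γ] ≅ L^N`, so after `R ⊗_L −` left multiplication by `x`
on `R ⊗_L L[γ]` is conjugate to the matrix `Ψ x` on `R^N`, and the norm — the determinant of the regular representation — is `det (Ψ x)`.
[cite: HornJohnson2013, Thm 3.2.4.2, p0236] [cite: Lang2002, Ch. VI §5 Prop. 5.6] -/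
theorem det_eq_norm_of_apply_tmul (hreg : γ.charpoly.Separable)
    (Ψ : R ⊗[L] ↥(Algebra.adjoin L ({γ} : Set (Matrix (Fin N) (Fin N) L))) →ₐ[R] Matrix (Fin N) (Fin N) R)
    (hΨ : ∀ (r : R) (b : ↥(Algebra.adjoin L ({γ} : Set (Matrix (Fin N) (Fin N) L)))),
      Ψ (r ⊗ₜ b) = r • (b : Matrix (Fin N) (Fin N) L).map (algebraMap L R))
    (x : R ⊗[L] ↥(Algebra.adjoin L ({γ} : Set (Matrix (Fin N) (Fin N) L)))) :
    (Ψ x).det = Algebra.norm R x := by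
  classical
  -- a cyclic vector `v` of `γ`: `bV k = γ^k v` is a basis of `L^N`
  have hmin : minpoly L γ = γ.charpoly := minpoly_eq_charpoly_of_charpoly_separable γ hreg
  have hN : ¬ (N = 0) → Nontrivial (Matrix (Fin N) (Fin N) L) := fun h =>
    haveI : Nonempty (Fin N) := ⟨⟨0, Nat.pos_of_ne_zero h⟩⟩
    inferInstance
  by_cases hN0 : N = 0
  · subst hN0
    haveI : Subsingleton (R ⊗[L] ↥(Algebra.adjoin L ({γ} : Set (Matrix (Fin 0) (Fin 0) L)))) := by
      haveI : Subsingleton ↥(Algebra.adjoin L ({γ} : Set (Matrix (Fin 0) (Fin 0) L))) :=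
        ⟨fun a b => Subtype.ext (Subsingleton.elim _ _)⟩
      infer_instance
    rw [Matrix.det_isEmpty, Subsingleton.elim x 1, map_one]
  haveI := hN hN0
  have hφ : (minpoly L (Matrix.toLin' γ)).natDegree = Module.finrank L (Fin N → L) := by
    rw [Matrix.minpoly_toLin', hmin, Matrix.charpoly_natDegree_eq_dim, Module.finrank_fin_fun, Fintype.card_fin]
  obtain ⟨v, bV, hbV, -⟩ := exists_basis_toMatrix_eq_companion (Matrix.toLin' γ) hφ
  -- the evaluation map `φ : L[γ] → L^N`, `b ↦ b v`
  let φ : ↥(Algebra.adjoin L ({γ} : Set (Matrix (Fin N) (Fin N) L))) →ₗ[L] (Fin N → L) :=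
    { toFun := fun b => (b : Matrix (Fin N) (Fin N) L) *ᵥ v
      map_add' := fun b c => by simp only [Subalgebra.coe_add, Matrix.add_mulVec]
      map_smul' := fun c b => by simp only [Subalgebra.coe_smul, Matrix.smul_mulVec, RingHom.id_apply] }
  have hφapply : ∀ b : ↥(Algebra.adjoin L ({γ} : Set (Matrix (Fin N) (Fin N) L))), φ b = (b : Matrix (Fin N) (Fin N) L) *ᵥ v :=
    fun b => rfl
  have hφpow : ∀ k : ℕ, φ ⟨γ ^ k, Subalgebra.pow_mem _ (Algebra.self_mem_adjoin_singleton L γ) k⟩ = (Matrix.toLin' γ ^ k) v := by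
    intro k
    rw [hφapply, ← Matrix.toLin'_pow, Matrix.toLin'_apply]
  have hsurj : Function.Surjective φ := by
    rw [← LinearMap.range_eq_top, eq_top_iff, ← bV.span_eq, Submodule.span_le]
    rintro _ ⟨k, rfl⟩
    exact ⟨_, (hφpow k).trans (hbV k).symm⟩
  have hinj : Function.Injective φ := by
    rw [injective_iff_map_eq_zero]
    intro b hb
    rw [hφapply] at hb
    have hcomm : Commute (b : Matrix (Fin N) (Fin N) L) γ := commute_of_mem_adjoin_singleton b.2
    have h0 : Matrix.toLin' (b : Matrix (Fin N) (Fin N) L) = 0 := by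
      refine bV.ext fun k => ?_
      rw [LinearMap.zero_apply, hbV, ← Matrix.toLin'_pow, Matrix.toLin'_apply, Matrix.toLin'_apply, Matrix.mulVec_mulVec,
        (hcomm.pow_right k).eq, ← Matrix.mulVec_mulVec, hb, Matrix.mulVec_zero]
    exact Subtype.ext ((LinearEquiv.map_eq_zero_iff Matrix.toLin').mp h0)
  let φE : ↥(Algebra.adjoin L ({γ} : Set (Matrix (Fin N) (Fin N) L))) ≃ₗ[L] (Fin N → L) := LinearEquiv.ofBijective φ ⟨hinj, hsurj⟩
  -- base change to `R`: `Φ : R ⊗_L L[γ] ≃ R^N`, `Φ (t ⊗ d) = t • (d v)`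
  let Φ : R ⊗[L] ↥(Algebra.adjoin L ({γ} : Set (Matrix (Fin N) (Fin N) L))) ≃ₗ[R] (Fin N → R) :=
    (φE.baseChange L R _ (Fin N → L)).trans (TensorProduct.piScalarRight L R R (Fin N))
  have hΦ : ∀ (t : R) (d : ↥(Algebra.adjoin L ({γ} : Set (Matrix (Fin N) (Fin N) L)))),
      Φ (t ⊗ₜ d) = t • ((algebraMap L R) ∘ ((d : Matrix (Fin N) (Fin N) L) *ᵥ v)) := by
    intro t d
    ext i
    simp only [Φ, LinearEquiv.trans_apply, LinearEquiv.baseChange_tmul, TensorProduct.piScalarRight_apply,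
      TensorProduct.piScalarRightHom_tmul, Pi.smul_apply, Function.comp_apply, smul_eq_mul, Algebra.smul_def, mul_comm t]
    rfl
  -- key identity: `Φ (x y) = Ψ x · Φ y`
  have hkey : ∀ x y : R ⊗[L] ↥(Algebra.adjoin L ({γ} : Set (Matrix (Fin N) (Fin N) L))), Φ (x * y) = Ψ x *ᵥ Φ y := by
    intro x y
    induction x using TensorProduct.induction_on with
    | zero => simp only [zero_mul, map_zero, Matrix.zero_mulVec]
    | tmul r b =>
        induction y using TensorProduct.induction_on with
        | zero => simp only [mul_zero, map_zero, Matrix.mulVec_zero]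
        | tmul s c =>
            rw [Algebra.TensorProduct.tmul_mul_tmul, hΦ, hΦ, hΨ, Matrix.smul_mulVec, Matrix.mulVec_smul, smul_smul]
            congr 1
            ext i
            rw [Function.comp_apply, Subalgebra.coe_mul, ← Matrix.mulVec_mulVec, RingHom.map_mulVec]
        | add y z hy hz => simp only [mul_add, map_add, Matrix.mulVec_add, hy, hz]
    | add x z hx hz => simp only [add_mul, map_add, Matrix.add_mulVec, hx, hz]
  -- left multiplication by `x` is conjugate to the matrix `Ψ x`
  have hl : (Algebra.lmul R (R ⊗[L] ↥(Algebra.adjoin L ({γ} : Set (Matrix (Fin N) (Fin N) L)))) x :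
        Module.End R (R ⊗[L] ↥(Algebra.adjoin L ({γ} : Set (Matrix (Fin N) (Fin N) L))))) =
      (Φ.symm : (Fin N → R) →ₗ[R] _) ∘ₗ Matrix.toLin' (Ψ x) ∘ₗ (Φ.symm.symm : _ →ₗ[R] (Fin N → R)) := by
    refine LinearMap.ext fun y => ?_
    change x * y = Φ.symm (Matrix.toLin' (Ψ x) (Φ.symm.symm y))
    rw [LinearEquiv.symm_symm, Matrix.toLin'_apply, ← hkey, LinearEquiv.symm_apply_apply]
  rw [Algebra.norm_apply, hl, LinearMap.det_conj, LinearMap.det_toLin']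

/-- **`det (Ψ x) = ∏_𝔪 N_{(R ⊗_L K_𝔪)/R}((1 ⊗ π_𝔪) x)`**, `K_𝔪 = L[γ]∕𝔪` the simple factors of the (reduced: ★ `isReduced_adjoin_singleton`)
Cartan algebra of a regular semisimple `γ`: §3 + §2.  At `R = 𝔸_L` this is «`det x_g = ∏_𝔪 N_{K_𝔪/L}(x_𝔪)` as idèles» of the
obstruction computation [Rogawski1990, §3.5 p. 29–30]. [cite: Rogawski1990, §3.5 Prop. 3.5.2] [cite: HornJohnson2013, Thm 3.2.4.2, p0236] -/
theorem det_eq_prod_norm_map_mk (hreg : γ.charpoly.Separable)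
    [Fintype (MaximalSpectrum ↥(Algebra.adjoin L ({γ} : Set (Matrix (Fin N) (Fin N) L))))]
    (Ψ : R ⊗[L] ↥(Algebra.adjoin L ({γ} : Set (Matrix (Fin N) (Fin N) L))) →ₐ[R] Matrix (Fin N) (Fin N) R)
    (hΨ : ∀ (r : R) (b : ↥(Algebra.adjoin L ({γ} : Set (Matrix (Fin N) (Fin N) L)))),
      Ψ (r ⊗ₜ b) = r • (b : Matrix (Fin N) (Fin N) L).map (algebraMap L R))
    (x : R ⊗[L] ↥(Algebra.adjoin L ({γ} : Set (Matrix (Fin N) (Fin N) L)))) :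
    (Ψ x).det = ∏ I : MaximalSpectrum ↥(Algebra.adjoin L ({γ} : Set (Matrix (Fin N) (Fin N) L))),
      Algebra.norm R (Algebra.TensorProduct.map (AlgHom.id R R) (Ideal.Quotient.mkₐ L I.asIdeal) x) := by
  haveI := isReduced_adjoin_singleton γ hreg
  rw [det_eq_norm_of_apply_tmul γ R hreg Ψ hΨ x, norm_tensor_eq_prod_norm_map_mk L _ R x]

end DetNorm

end Literature.LinearAlgebra.Matrix
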